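import Mathlib.NumberTheory.LSeries.HurwitzZetaEven
import Mathlib.Analysis.Calculus.SmoothSeries
import Mathlib.Analysis.SpecialFunctions.Exp
import Mathlib.Analysis.SpecialFunctions.Pow.Real
import Literature.NumberTheory.LFunctions.DeBruijnNewmanProofs
import HarnessLib

/-!
# The Pólya–de Bruijn kernel `Φ` and Jacobi's theta function: evenness of `Φ`

Trunk T-ANT, `Literature/NumberTheory/LFunctions`; second companion ("Proofs") file of
`DeBruijnNewman.lean`, on top of `DeBruijnNewmanProofs.lean` (positivity of `Φ` on `[0, ∞)`,
summable majorants). We relate the kernel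
`Φ(u) = ∑_{n ≥ 1} (2π² n⁴ e^{9u} − 3π n² e^{5u}) exp(−π n² e^{4u})` (Rodgers–Tao normalisation) to
Jacobi's theta function `θ(x) = ∑_{n ∈ ℤ} exp(−π n² x)` (`HurwitzZeta.cosKernel 0` in Mathlib) through
the auxiliary functions

* `Literature.deBruijnThetaK u = e^{u} θ(e^{4u})`, which is **even** by the theta functional equation
  `θ(1/x) = √x θ(x)` (`HurwitzZeta.evenKernel_functional_equation`), and
* `Literature.deBruijnThetaM u = e^{u} (θ(e^{4u}) − 1) = 2 ∑_{n ≥ 1} exp(u − π n² e^{4u}) = deBruijnThetaK u − e^{u}`,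

and the identity (Titchmarsh §10.1, proof of (10.1.4); Pólya 1927)

  `16 Φ(u) = M''(u) − M(u)`,   `M = deBruijnThetaM`,

obtained by differentiating the series for `M` twice term by term. Since `M(−u) = M(u) + eᵘ − e⁻ᵘ`
(evenness of `deBruijnThetaK`) and `(eᵘ − e⁻ᵘ)'' = eᵘ − e⁻ᵘ`, the function `M'' − M` is even. This gives:

* `Literature.NumberTheory.LFunctions.deBruijnPhi_neg_holds`: **discharge** of `Literature.NumberTheory.LFunctions.deBruijnPhi_neg` (`Φ` is even), and
  `Literature.NumberTheory.LFunctions.deBruijnPhi_pos_holds`: **discharge** of `Literature.NumberTheory.LFunctions.deBruijnPhi_pos` (`Φ > 0` on `ℝ`), from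
  evenness and positivity on `[0, ∞)` (`Literature.NumberTheory.LFunctions.deBruijnPhi_pos_of_nonneg`, `DeBruijnNewmanProofs.lean`);
* `Literature.NumberTheory.LFunctions.continuous_deBruijnPhi`: `Φ = (M'' − M)/16` is continuous on `ℝ`;
* `Literature.NumberTheory.LFunctions.deBruijnThetaM₁_zero`: `M'(0) = −1` (equivalently `4θ'(1) + θ(1) = 0`), the boundary term in
  Riemann's integral representation `H_0 = Ξ(·/2)/8` (planned sequel `DeBruijnHZeroProofs.lean`,
  which discharges `Literature.NumberTheory.LFunctions.deBruijnH_zero_eq` from the results of this file);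
* growth bounds `|M(u)|, |M'(u)|, |M''(u)| ≤ C exp(9u − π e^{4u})` on `u ≥ 0`
  (`Literature.NumberTheory.LFunctions.exists_deBruijnThetaM_bound`) and integrability / decay of `exp(cu − π e^{4u})` on `(0, ∞)`.

Mathlib has Jacobi's theta function (`jacobiTheta₂`, `HurwitzZeta.cosKernel`, `evenKernel`) with its
functional equation and the completed zeta function as its Mellin transform, but no term-by-term
derivatives of `θ(e^{4u})` and nothing on `Φ` (searched `deBruijn`, `cosKernel`, `jacobiTheta`, `deriv`).

## References

* E. C. Titchmarsh, *The theory of the Riemann zeta-function*, 2nd ed. (1986), §10.1.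
* G. Pólya, *Über trigonometrische Integrale mit nur reellen Nullstellen*, J. reine angew. Math.
  158 (1927), 6–18.
* G. Csordas, T. S. Norfolk, R. S. Varga, *The Riemann hypothesis and the Turán inequalities*,
  Trans. AMS 296 (1986), Thm. A.
* B. Rodgers, T. Tao, *The de Bruijn–Newman constant is non-negative*, Forum Math. Pi 8 (2020), §1.
-/

noncomputable section

open Real Set Filter Topology HurwitzZeta

namespace Literature.NumberTheory.LFunctions

/-! ## The series `M(u) = 2 ∑ exp(u − π (n+1)² e^{4u})` and its first two derivatives -/

/-- The `n`-th term `2 exp(u − π (n+1)² e^{4u})` of `M`. [folklore] -/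
def deBruijnThetaMTerm (n : ℕ) (u : ℝ) : ℝ :=
  2 * rexp (u - π * ((n : ℝ) + 1) ^ 2 * rexp (4 * u))

/-- The `u`-derivative of `deBruijnThetaMTerm n`. [folklore] -/
def deBruijnThetaMTerm₁ (n : ℕ) (u : ℝ) : ℝ :=
  2 * ((1 - 4 * π * ((n : ℝ) + 1) ^ 2 * rexp (4 * u)) *
    rexp (u - π * ((n : ℝ) + 1) ^ 2 * rexp (4 * u)))

/-- The second `u`-derivative of `deBruijnThetaMTerm n`. [folklore] -/
def deBruijnThetaMTerm₂ (n : ℕ) (u : ℝ) : ℝ :=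
  2 * (((1 - 4 * π * ((n : ℝ) + 1) ^ 2 * rexp (4 * u)) ^ 2 -
      16 * π * ((n : ℝ) + 1) ^ 2 * rexp (4 * u)) *
    rexp (u - π * ((n : ℝ) + 1) ^ 2 * rexp (4 * u)))

/-- `M(u) = 2 ∑_{n ≥ 1} exp(u − π n² e^{4u}) = e^{u} (θ(e^{4u}) − 1)` (Titchmarsh §10.1, with
`x = e^{4u}`). [cite: Titchmarsh1986, §10.1] -/
def deBruijnThetaM (u : ℝ) : ℝ := ∑' n : ℕ, deBruijnThetaMTerm n u

/-- `M'(u)`, as the term-by-term derivative. [folklore] -/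
def deBruijnThetaM₁ (u : ℝ) : ℝ := ∑' n : ℕ, deBruijnThetaMTerm₁ n u

/-- `M''(u)`, as the term-by-term second derivative. [folklore] -/
def deBruijnThetaM₂ (u : ℝ) : ℝ := ∑' n : ℕ, deBruijnThetaMTerm₂ n u

/-- `K(u) = e^{u} θ(e^{4u})` with `θ = HurwitzZeta.cosKernel 0 = ∑_{n ∈ ℤ} exp(−π n² ·)`. [folklore] -/
def deBruijnThetaK (u : ℝ) : ℝ := rexp u * cosKernel 0 (rexp (4 * u))

/-- `d/du deBruijnThetaMTerm n = deBruijnThetaMTerm₁ n`. [folklore] -/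
theorem hasDerivAt_deBruijnThetaMTerm (n : ℕ) (u : ℝ) :
    HasDerivAt (deBruijnThetaMTerm n) (deBruijnThetaMTerm₁ n u) u := by
  have h4 : HasDerivAt (fun y : ℝ ↦ rexp (4 * y)) (rexp (4 * u) * (4 * 1)) u :=
    ((hasDerivAt_id u).const_mul 4).exp
  have hin : HasDerivAt (fun y : ℝ ↦ y - π * ((n : ℝ) + 1) ^ 2 * rexp (4 * y))
      (1 - π * ((n : ℝ) + 1) ^ 2 * (rexp (4 * u) * (4 * 1))) u :=
    (hasDerivAt_id u).sub (h4.const_mul _)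
  have := (hin.exp).const_mul 2
  refine this.congr_deriv ?_
  unfold deBruijnThetaMTerm₁; ring

/-- `d/du deBruijnThetaMTerm₁ n = deBruijnThetaMTerm₂ n`. [folklore] -/
theorem hasDerivAt_deBruijnThetaMTerm₁ (n : ℕ) (u : ℝ) :
    HasDerivAt (deBruijnThetaMTerm₁ n) (deBruijnThetaMTerm₂ n u) u := by
  have h4 : HasDerivAt (fun y : ℝ ↦ rexp (4 * y)) (rexp (4 * u) * (4 * 1)) u :=
    ((hasDerivAt_id u).const_mul 4).exp
  have hin : HasDerivAt (fun y : ℝ ↦ y - π * ((n : ℝ) + 1) ^ 2 * rexp (4 * y))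
      (1 - π * ((n : ℝ) + 1) ^ 2 * (rexp (4 * u) * (4 * 1))) u :=
    (hasDerivAt_id u).sub (h4.const_mul _)
  have hlin : HasDerivAt (fun y : ℝ ↦ 1 - 4 * π * ((n : ℝ) + 1) ^ 2 * rexp (4 * y))
      (0 - 4 * π * ((n : ℝ) + 1) ^ 2 * (rexp (4 * u) * (4 * 1))) u :=
    (hasDerivAt_const u 1).sub (h4.const_mul _)
  have := (hlin.mul hin.exp).const_mul 2
  refine this.congr_deriv ?_
  unfold deBruijnThetaMTerm₂; ring

/-- The termwise identity `deBruijnThetaMTerm₂ n − deBruijnThetaMTerm n = 16 · deBruijnPhiSummand n`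
(`e^{u} e^{8u} = e^{9u}`, `e^{u} e^{4u} = e^{5u}`). [cite: Titchmarsh1986, §10.1] -/
theorem deBruijnThetaMTerm₂_sub_deBruijnThetaMTerm (n : ℕ) (u : ℝ) :
    deBruijnThetaMTerm₂ n u - deBruijnThetaMTerm n u = 16 * deBruijnPhiSummand n u := by
  have hsub : rexp (u - π * ((n : ℝ) + 1) ^ 2 * rexp (4 * u)) =
      rexp u * rexp (-(π * ((n : ℝ) + 1) ^ 2 * rexp (4 * u))) := by
    rw [← Real.exp_add]; ring_nf
  have h9 : rexp (9 * u) = rexp u * rexp (4 * u) ^ 2 := by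
    rw [sq, ← Real.exp_add, ← Real.exp_add]; ring_nf
  have h5 : rexp (5 * u) = rexp u * rexp (4 * u) := by
    rw [← Real.exp_add]; ring_nf
  simp only [deBruijnThetaMTerm₂, deBruijnThetaMTerm, deBruijnPhiSummand, hsub, h9, h5]
  ring

/-! ## `M` and Jacobi's theta function -/

/-- `M(u) = e^{u} (θ(e^{4u}) − 1)`: the series `2 ∑ exp(u − π (n+1)² e^{4u})` sums to
`deBruijnThetaK u − e^{u}` (`HurwitzZeta.hasSum_nat_cosKernel₀`). [cite: Titchmarsh1986, §10.1] -/
theorem hasSum_deBruijnThetaMTerm (u : ℝ) : HasSum (fun n ↦ deBruijnThetaMTerm n u) (deBruijnThetaK u - rexp u) := by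
  have ht : 0 < rexp (4 * u) := Real.exp_pos _
  have h := (hasSum_nat_cosKernel₀ 0 ht).mul_left (rexp u)
  simp only [mul_zero, zero_mul, Real.cos_zero, mul_one, QuotientAddGroup.mk_zero] at h
  have hK : rexp u * (cosKernel 0 (rexp (4 * u)) - 1) = deBruijnThetaK u - rexp u := by
    unfold deBruijnThetaK; ring
  rw [hK] at h
  refine h.congr_fun fun n ↦ ?_
  change deBruijnThetaMTerm n u = rexp u * (2 * rexp (-π * ((n : ℝ) + 1) ^ 2 * rexp (4 * u)))
  rw [deBruijnThetaMTerm, Real.exp_sub, div_eq_mul_inv, ← Real.exp_neg]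
  ring_nf

/-- The series for `M(u)` converges. [folklore] -/
theorem summable_deBruijnThetaMTerm (u : ℝ) : Summable fun n ↦ deBruijnThetaMTerm n u :=
  (hasSum_deBruijnThetaMTerm u).summable

/-- `M(u) = K(u) − e^{u}`. [cite: Titchmarsh1986, §10.1] -/
theorem deBruijnThetaM_eq (u : ℝ) : deBruijnThetaM u = deBruijnThetaK u - rexp u :=
  (hasSum_deBruijnThetaMTerm u).tsum_eq

/-- **Evenness of `K`** from the theta functional equation `θ(x) = x^{-1/2} θ(1/x)`
(`HurwitzZeta.evenKernel_functional_equation`): `e^{u} θ(e^{4u}) = e^{−u} θ(e^{−4u})`.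
[cite: Titchmarsh1986, §10.1] -/
theorem deBruijnThetaK_neg (u : ℝ) : deBruijnThetaK (-u) = deBruijnThetaK u := by
  have hfe := evenKernel_functional_equation (0 : UnitAddCircle) (rexp (4 * u))
  rw [evenKernel_eq_cosKernel_of_zero] at hfe
  have hhalf : rexp (4 * u) ^ (1 / 2 : ℝ) = rexp (2 * u) := by
    rw [← Real.exp_mul]; ring_nf
  have hinv : 1 / rexp (4 * u) = rexp (4 * -u) := by
    rw [one_div, ← Real.exp_neg]; ring_nf
  rw [hhalf, hinv] at hfe
  unfold deBruijnThetaK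
  rw [hfe]
  have : rexp u * (1 / rexp (2 * u)) = rexp (-u) := by
    rw [one_div, ← Real.exp_neg, ← Real.exp_add]; ring_nf
  rw [← mul_assoc, this]

/-- `M(−u) = M(u) + e^{u} − e^{−u}`. [cite: Titchmarsh1986, §10.1] -/
theorem deBruijnThetaM_neg (u : ℝ) : deBruijnThetaM (-u) = deBruijnThetaM u + rexp u - rexp (-u) := by
  rw [deBruijnThetaM_eq, deBruijnThetaM_eq, deBruijnThetaK_neg]
  ring

/-! ## Local bounds for the terms and term-by-term differentiation -/

/-- The summable majorant `∑ (n+1)⁴ exp(−π e^{4b} (n+1)) < ∞` (the instance `k = 4`,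
`r = π e^{4b}` of `summable_succ_pow_mul_exp_neg_mul` from `DeBruijnNewmanProofs.lean`). [folklore] -/
theorem summable_deBruijnThetaMajorant (b : ℝ) :
    Summable fun n : ℕ ↦ ((n : ℝ) + 1) ^ 4 * rexp (-(π * rexp (4 * b) * ((n : ℝ) + 1))) :=
  summable_succ_pow_mul_exp_neg_mul 4 (by positivity)

/-- On `b ≤ u ≤ c`: `exp(u − π (n+1)² e^{4u}) ≤ e^{c} exp(−π e^{4b} (n+1))`. [folklore] -/
theorem exp_deBruijnThetaPhase_le {b c u : ℝ} (hb : b ≤ u) (hc : u ≤ c) (n : ℕ) :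
    rexp (u - π * ((n : ℝ) + 1) ^ 2 * rexp (4 * u)) ≤
      rexp c * rexp (-(π * rexp (4 * b) * ((n : ℝ) + 1))) := by
  rw [← Real.exp_add]
  apply Real.exp_monotone
  set m : ℝ := (n : ℝ) + 1 with hm
  have hm1 : 1 ≤ m := by simp [hm]
  have h4 : rexp (4 * b) ≤ rexp (4 * u) := Real.exp_monotone (by linarith)
  have h4pos : 0 < rexp (4 * b) := Real.exp_pos _
  have hmm : m ≤ m ^ 2 := by nlinarith
  have : π * rexp (4 * b) * m ≤ π * m ^ 2 * rexp (4 * u) := by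
    calc π * rexp (4 * b) * m ≤ π * rexp (4 * b) * m ^ 2 := by gcongr
      _ = π * m ^ 2 * rexp (4 * b) := by ring
      _ ≤ π * m ^ 2 * rexp (4 * u) := by gcongr
  linarith

/-- On `u ≤ c`: `|1 − 4π (n+1)² e^{4u}| ≤ (1 + 4π e^{4c}) (n+1)²`. [folklore] -/
theorem abs_deBruijnThetaLin_le {c u : ℝ} (hc : u ≤ c) (n : ℕ) :
    |1 - 4 * π * ((n : ℝ) + 1) ^ 2 * rexp (4 * u)| ≤
      (1 + 4 * π * rexp (4 * c)) * ((n : ℝ) + 1) ^ 2 := by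
  set m : ℝ := (n : ℝ) + 1 with hm
  have hm1 : 1 ≤ m ^ 2 := by nlinarith [show (1 : ℝ) ≤ m by simp [hm]]
  have h4 : rexp (4 * u) ≤ rexp (4 * c) := Real.exp_monotone (by linarith)
  have hnn : 0 ≤ 4 * π * m ^ 2 * rexp (4 * u) := by positivity
  refine (abs_sub _ _).trans ?_
  rw [abs_one, abs_of_nonneg hnn]
  have : 4 * π * m ^ 2 * rexp (4 * u) ≤ 4 * π * rexp (4 * c) * m ^ 2 := by
    calc 4 * π * m ^ 2 * rexp (4 * u) ≤ 4 * π * m ^ 2 * rexp (4 * c) := by gcongr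
      _ = 4 * π * rexp (4 * c) * m ^ 2 := by ring
  nlinarith

/-- On `u ≤ c`: `|(1 − 4π (n+1)² e^{4u})² − 16π (n+1)² e^{4u}| ≤ ((1 + 4π e^{4c})² + 16π e^{4c}) (n+1)⁴`.
[folklore] -/
theorem abs_deBruijnThetaQuad_le {c u : ℝ} (hc : u ≤ c) (n : ℕ) :
    |(1 - 4 * π * ((n : ℝ) + 1) ^ 2 * rexp (4 * u)) ^ 2 -
        16 * π * ((n : ℝ) + 1) ^ 2 * rexp (4 * u)| ≤
      ((1 + 4 * π * rexp (4 * c)) ^ 2 + 16 * π * rexp (4 * c)) * ((n : ℝ) + 1) ^ 4 := by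
  set m : ℝ := (n : ℝ) + 1 with hm
  have hm1 : 1 ≤ m ^ 2 := by nlinarith [show (1 : ℝ) ≤ m by simp [hm]]
  have h4 : rexp (4 * u) ≤ rexp (4 * c) := Real.exp_monotone (by linarith)
  have hsq : (1 - 4 * π * m ^ 2 * rexp (4 * u)) ^ 2 ≤ ((1 + 4 * π * rexp (4 * c)) * m ^ 2) ^ 2 := by
    have h := abs_deBruijnThetaLin_le hc n
    rw [← hm] at h
    have h0 : 0 ≤ (1 + 4 * π * rexp (4 * c)) * m ^ 2 := by positivity
    calc (1 - 4 * π * m ^ 2 * rexp (4 * u)) ^ 2 = |1 - 4 * π * m ^ 2 * rexp (4 * u)| ^ 2 := by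
          rw [sq_abs]
      _ ≤ ((1 + 4 * π * rexp (4 * c)) * m ^ 2) ^ 2 := by
          exact pow_le_pow_left₀ (abs_nonneg _) h 2
  have hlin : 16 * π * m ^ 2 * rexp (4 * u) ≤ 16 * π * rexp (4 * c) * m ^ 4 := by
    have : m ^ 2 ≤ m ^ 4 := by nlinarith
    calc 16 * π * m ^ 2 * rexp (4 * u) ≤ 16 * π * m ^ 4 * rexp (4 * c) := by gcongr
      _ = 16 * π * rexp (4 * c) * m ^ 4 := by ring
  refine (abs_sub _ _).trans ?_
  rw [abs_of_nonneg (sq_nonneg _), abs_of_nonneg (by positivity)]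
  nlinarith

/-- Local bound for the terms of `M`: on `b ≤ u ≤ c`,
`|deBruijnThetaMTerm n u| ≤ 2 e^{c} · (n+1)⁴ exp(−π e^{4b} (n+1))`. [folklore] -/
theorem abs_deBruijnThetaMTerm_le {b c u : ℝ} (hb : b ≤ u) (hc : u ≤ c) (n : ℕ) :
    |deBruijnThetaMTerm n u| ≤
      2 * rexp c * (((n : ℝ) + 1) ^ 4 * rexp (-(π * rexp (4 * b) * ((n : ℝ) + 1)))) := by
  have hm4 : (1 : ℝ) ≤ ((n : ℝ) + 1) ^ 4 := one_le_pow₀ (by simp)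
  rw [deBruijnThetaMTerm, abs_mul, abs_two, abs_of_pos (Real.exp_pos _)]
  calc 2 * rexp (u - π * ((n : ℝ) + 1) ^ 2 * rexp (4 * u))
      ≤ 2 * (rexp c * rexp (-(π * rexp (4 * b) * ((n : ℝ) + 1)))) := by
        gcongr; exact exp_deBruijnThetaPhase_le hb hc n
    _ = 2 * rexp c * (1 * rexp (-(π * rexp (4 * b) * ((n : ℝ) + 1)))) := by ring
    _ ≤ 2 * rexp c * (((n : ℝ) + 1) ^ 4 * rexp (-(π * rexp (4 * b) * ((n : ℝ) + 1)))) := by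
        gcongr

/-- Local bound for the terms of `M'`. [folklore] -/
theorem abs_deBruijnThetaMTerm₁_le {b c u : ℝ} (hb : b ≤ u) (hc : u ≤ c) (n : ℕ) :
    |deBruijnThetaMTerm₁ n u| ≤ 2 * (1 + 4 * π * rexp (4 * c)) * rexp c *
      (((n : ℝ) + 1) ^ 4 * rexp (-(π * rexp (4 * b) * ((n : ℝ) + 1)))) := by
  set m : ℝ := (n : ℝ) + 1 with hm
  have hm24 : m ^ 2 ≤ m ^ 4 := by nlinarith [show (1 : ℝ) ≤ m ^ 2 by nlinarith [show (1 : ℝ) ≤ m by simp [hm]]]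
  rw [deBruijnThetaMTerm₁, abs_mul, abs_two, abs_mul, abs_of_pos (Real.exp_pos _)]
  have h1 := abs_deBruijnThetaLin_le hc n
  have h2 := exp_deBruijnThetaPhase_le hb hc n
  rw [← hm] at h1 h2
  calc 2 * (|1 - 4 * π * m ^ 2 * rexp (4 * u)| * rexp (u - π * m ^ 2 * rexp (4 * u)))
      ≤ 2 * (((1 + 4 * π * rexp (4 * c)) * m ^ 2) *
          (rexp c * rexp (-(π * rexp (4 * b) * m)))) := by gcongr
    _ ≤ 2 * (((1 + 4 * π * rexp (4 * c)) * m ^ 4) *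
          (rexp c * rexp (-(π * rexp (4 * b) * m)))) := by gcongr
    _ = _ := by ring

/-- Local bound for the terms of `M''`. [folklore] -/
theorem abs_deBruijnThetaMTerm₂_le {b c u : ℝ} (hb : b ≤ u) (hc : u ≤ c) (n : ℕ) :
    |deBruijnThetaMTerm₂ n u| ≤ 2 * ((1 + 4 * π * rexp (4 * c)) ^ 2 + 16 * π * rexp (4 * c)) * rexp c *
      (((n : ℝ) + 1) ^ 4 * rexp (-(π * rexp (4 * b) * ((n : ℝ) + 1)))) := by
  set m : ℝ := (n : ℝ) + 1 with hm
  rw [deBruijnThetaMTerm₂, abs_mul, abs_two, abs_mul, abs_of_pos (Real.exp_pos _)]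
  have h1 := abs_deBruijnThetaQuad_le hc n
  have h2 := exp_deBruijnThetaPhase_le hb hc n
  rw [← hm] at h1 h2
  calc 2 * (|(1 - 4 * π * m ^ 2 * rexp (4 * u)) ^ 2 - 16 * π * m ^ 2 * rexp (4 * u)| *
          rexp (u - π * m ^ 2 * rexp (4 * u)))
      ≤ 2 * ((((1 + 4 * π * rexp (4 * c)) ^ 2 + 16 * π * rexp (4 * c)) * m ^ 4) *
          (rexp c * rexp (-(π * rexp (4 * b) * m)))) := by gcongr
    _ = _ := by ring

/-- The series for `M'(u)` converges. [folklore] -/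
theorem summable_deBruijnThetaMTerm₁ (u : ℝ) : Summable fun n ↦ deBruijnThetaMTerm₁ n u :=
  .of_norm_bounded ((summable_deBruijnThetaMajorant u).mul_left _) fun n ↦
    (Real.norm_eq_abs _).le.trans (abs_deBruijnThetaMTerm₁_le le_rfl le_rfl n)

/-- The series for `M''(u)` converges. [folklore] -/
theorem summable_deBruijnThetaMTerm₂ (u : ℝ) : Summable fun n ↦ deBruijnThetaMTerm₂ n u :=
  .of_norm_bounded ((summable_deBruijnThetaMajorant u).mul_left _) fun n ↦
    (Real.norm_eq_abs _).le.trans (abs_deBruijnThetaMTerm₂_le le_rfl le_rfl n)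

/-- **Term-by-term differentiation**: `M' = deBruijnThetaM₁`. [cite: Titchmarsh1986, §10.1] -/
theorem hasDerivAt_deBruijnThetaM (a : ℝ) : HasDerivAt deBruijnThetaM (deBruijnThetaM₁ a) a := by
  have hmem : a ∈ Ioo (a - 1) (a + 1) := by constructor <;> linarith
  exact hasDerivAt_tsum_of_isPreconnected (g := fun n y ↦ deBruijnThetaMTerm n y)
    (g' := fun n y ↦ deBruijnThetaMTerm₁ n y) (t := Ioo (a - 1) (a + 1))
    ((summable_deBruijnThetaMajorant (a - 1)).mul_left (2 * (1 + 4 * π * rexp (4 * (a + 1))) * rexp (a + 1)))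
    isOpen_Ioo isPreconnected_Ioo (fun n y _ ↦ hasDerivAt_deBruijnThetaMTerm n y)
    (fun n y hy ↦ (Real.norm_eq_abs _).le.trans (abs_deBruijnThetaMTerm₁_le hy.1.le hy.2.le n)) hmem
    (summable_deBruijnThetaMTerm a) hmem

/-- **Term-by-term differentiation**: `M'' = deBruijnThetaM₂`. [cite: Titchmarsh1986, §10.1] -/
theorem hasDerivAt_deBruijnThetaM₁ (a : ℝ) : HasDerivAt deBruijnThetaM₁ (deBruijnThetaM₂ a) a := by
  have hmem : a ∈ Ioo (a - 1) (a + 1) := by constructor <;> linarith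
  exact hasDerivAt_tsum_of_isPreconnected (g := fun n y ↦ deBruijnThetaMTerm₁ n y)
    (g' := fun n y ↦ deBruijnThetaMTerm₂ n y) (t := Ioo (a - 1) (a + 1))
    ((summable_deBruijnThetaMajorant (a - 1)).mul_left
      (2 * ((1 + 4 * π * rexp (4 * (a + 1))) ^ 2 + 16 * π * rexp (4 * (a + 1))) * rexp (a + 1)))
    isOpen_Ioo isPreconnected_Ioo (fun n y _ ↦ hasDerivAt_deBruijnThetaMTerm₁ n y)
    (fun n y hy ↦ (Real.norm_eq_abs _).le.trans (abs_deBruijnThetaMTerm₂_le hy.1.le hy.2.le n)) hmem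
    (summable_deBruijnThetaMTerm₁ a) hmem

/-- `M` is differentiable, hence continuous. [folklore] -/
theorem differentiable_deBruijnThetaM : Differentiable ℝ deBruijnThetaM := fun a ↦
  (hasDerivAt_deBruijnThetaM a).differentiableAt

/-- `M'` is differentiable, hence continuous. [folklore] -/
theorem differentiable_deBruijnThetaM₁ : Differentiable ℝ deBruijnThetaM₁ := fun a ↦
  (hasDerivAt_deBruijnThetaM₁ a).differentiableAt

/-- `deriv M = deBruijnThetaM₁`. [folklore] -/
theorem deriv_deBruijnThetaM : deriv deBruijnThetaM = deBruijnThetaM₁ := funext fun a ↦ (hasDerivAt_deBruijnThetaM a).deriv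

/-- `deriv M' = deBruijnThetaM₂`. [folklore] -/
theorem deriv_deBruijnThetaM₁ : deriv deBruijnThetaM₁ = deBruijnThetaM₂ := funext fun a ↦ (hasDerivAt_deBruijnThetaM₁ a).deriv

/-- `M''` is continuous (locally uniformly convergent series of continuous functions). [folklore] -/
theorem continuous_deBruijnThetaM₂ : Continuous deBruijnThetaM₂ := by
  refine continuous_iff_continuousAt.2 fun a ↦ ?_
  have hmem : Ioo (a - 1) (a + 1) ∈ 𝓝 a := Ioo_mem_nhds (by linarith) (by linarith)
  have hterm : ∀ n, Continuous (deBruijnThetaMTerm₂ n) := fun n ↦ by unfold deBruijnThetaMTerm₂; fun_prop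
  have hcont : ContinuousOn deBruijnThetaM₂ (Ioo (a - 1) (a + 1)) :=
    continuousOn_tsum (fun n ↦ (hterm n).continuousOn)
      ((summable_deBruijnThetaMajorant (a - 1)).mul_left
        (2 * ((1 + 4 * π * rexp (4 * (a + 1))) ^ 2 + 16 * π * rexp (4 * (a + 1))) * rexp (a + 1)))
      fun n y hy ↦ (Real.norm_eq_abs _).le.trans (abs_deBruijnThetaMTerm₂_le hy.1.le hy.2.le n)
  exact hcont.continuousAt hmem

/-! ## `16 Φ = M'' − M`; evenness and positivity of `Φ` -/

/-- **Titchmarsh's identity** `16 Φ(u) = M''(u) − M(u)` (Titchmarsh §10.1, the computation behind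
(10.1.4), in the variable `x = e^{4u}`: `Φ(u) = 2 x^{3/4} (x^{3/2} ψ'(x))'` with `ψ = (θ − 1)/2`).
[cite: Titchmarsh1986, §10.1] -/
theorem deBruijnThetaM₂_sub_deBruijnThetaM (u : ℝ) : deBruijnThetaM₂ u - deBruijnThetaM u = 16 * deBruijnPhi u := by
  rw [deBruijnThetaM₂, deBruijnThetaM, ← (summable_deBruijnThetaMTerm₂ u).tsum_sub (summable_deBruijnThetaMTerm u), deBruijnPhi,
    ← tsum_mul_left]
  exact tsum_congr fun n ↦ deBruijnThetaMTerm₂_sub_deBruijnThetaMTerm n u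

/-- `−M'(−u) = M'(u) + e^{u} + e^{−u}` (derivative of `deBruijnThetaM_neg`). [folklore] -/
theorem deBruijnThetaM₁_neg (u : ℝ) : -deBruijnThetaM₁ (-u) = deBruijnThetaM₁ u + rexp u + rexp (-u) := by
  -- differentiate `fun u ↦ deBruijnThetaM (-u)` in two ways
  have h1 : HasDerivAt (fun v : ℝ ↦ deBruijnThetaM (-v)) (deBruijnThetaM₁ (-u) * -1) u :=
    (hasDerivAt_deBruijnThetaM (-u)).comp u (hasDerivAt_neg u)
  have h2 : HasDerivAt (fun v : ℝ ↦ deBruijnThetaM v + rexp v - rexp (-v))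
      (deBruijnThetaM₁ u + rexp u - rexp (-u) * -1) u :=
    ((hasDerivAt_deBruijnThetaM u).add (Real.hasDerivAt_exp u)).sub
      ((Real.hasDerivAt_exp (-u)).comp u (hasDerivAt_neg u))
  have heq : (fun v : ℝ ↦ deBruijnThetaM (-v)) = fun v ↦ deBruijnThetaM v + rexp v - rexp (-v) :=
    funext deBruijnThetaM_neg
  rw [heq] at h1
  have := h1.unique h2
  linarith

/-- `M''(−u) = M''(u) + e^{u} − e^{−u}` (second derivative of `deBruijnThetaM_neg`). [folklore] -/
theorem deBruijnThetaM₂_neg (u : ℝ) : deBruijnThetaM₂ (-u) = deBruijnThetaM₂ u + rexp u - rexp (-u) := by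
  have h1 : HasDerivAt (fun v : ℝ ↦ -deBruijnThetaM₁ (-v)) (-(deBruijnThetaM₂ (-u) * -1)) u :=
    ((hasDerivAt_deBruijnThetaM₁ (-u)).comp u (hasDerivAt_neg u)).neg
  have h2 : HasDerivAt (fun v : ℝ ↦ deBruijnThetaM₁ v + rexp v + rexp (-v))
      (deBruijnThetaM₂ u + rexp u + rexp (-u) * -1) u :=
    ((hasDerivAt_deBruijnThetaM₁ u).add (Real.hasDerivAt_exp u)).add
      ((Real.hasDerivAt_exp (-u)).comp u (hasDerivAt_neg u))
  have heq : (fun v : ℝ ↦ -deBruijnThetaM₁ (-v)) = fun v ↦ deBruijnThetaM₁ v + rexp v + rexp (-v) :=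
    funext deBruijnThetaM₁_neg
  rw [heq] at h1
  have := h1.unique h2
  linarith

/-- `M'(0) = −1` (equivalently `θ(1) + 4θ'(1) = 0`, the derivative of the theta functional
equation at its fixed point). [cite: Titchmarsh1986, §10.1] -/
theorem deBruijnThetaM₁_zero : deBruijnThetaM₁ 0 = -1 := by
  have := deBruijnThetaM₁_neg 0
  rw [neg_zero, Real.exp_zero] at this
  linarith

/-- **Discharge** of `Literature.NumberTheory.LFunctions.deBruijnPhi_neg`: `Φ(−u) = Φ(u)` (Pólya 1927; Titchmarsh §10.1: a
consequence of the functional equation of `θ`). [cite: Titchmarsh1986, §10.1] -/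
theorem deBruijnPhi_neg_holds : deBruijnPhi_neg := by
  intro u
  have h1 := deBruijnThetaM₂_sub_deBruijnThetaM (-u)
  have h2 := deBruijnThetaM₂_sub_deBruijnThetaM u
  rw [deBruijnThetaM₂_neg, deBruijnThetaM_neg] at h1
  linarith

/-- **Discharge** of `Literature.NumberTheory.LFunctions.deBruijnPhi_pos`: `Φ(u) > 0` for every real `u` — on `[0, ∞)` this is
`deBruijnPhi_pos_of_nonneg` (`DeBruijnNewmanProofs.lean`: each summand is positive there), and
`Φ` is even (`deBruijnPhi_neg_holds`). [cite: Titchmarsh1986, §10.1] -/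
theorem deBruijnPhi_pos_holds : deBruijnPhi_pos := by
  intro u
  rcases le_total 0 u with hu | hu
  · exact deBruijnPhi_pos_of_nonneg hu
  · rw [← deBruijnPhi_neg_holds u]
    exact deBruijnPhi_pos_of_nonneg (neg_nonneg.mpr hu)

/-- `Φ = (M'' − M)/16` is continuous on `ℝ`. [folklore] -/
theorem continuous_deBruijnPhi : Continuous deBruijnPhi := by
  have : deBruijnPhi = fun u ↦ (deBruijnThetaM₂ u - deBruijnThetaM u) / 16 := by
    funext u; rw [deBruijnThetaM₂_sub_deBruijnThetaM]; ring
  rw [this]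
  exact (continuous_deBruijnThetaM₂.sub differentiable_deBruijnThetaM.continuous).div_const _

/-! ## Growth of `M`, `M'`, `M''` on `[0, ∞)` -/

/-- `S₄ = ∑ (n+1)⁴ e^{−π (n+1)}`, the constant in the growth bounds. [folklore] -/
def deBruijnThetaS₄ : ℝ := ∑' n : ℕ, ((n : ℝ) + 1) ^ 4 * rexp (-(π * ((n : ℝ) + 1)))

/-- The series `S₄` converges. [folklore] -/
theorem hasSum_deBruijnThetaS₄ :
    HasSum (fun n : ℕ ↦ ((n : ℝ) + 1) ^ 4 * rexp (-(π * ((n : ℝ) + 1)))) deBruijnThetaS₄ := by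
  have := summable_deBruijnThetaMajorant 0
  simp only [mul_zero, Real.exp_zero, mul_one] at this
  exact this.hasSum

/-- For `u ≥ 0`: `∑ (n+1)⁴ exp(−π e^{4u} (n+1)) ≤ S₄ e^{π} exp(−π e^{4u})`. [folklore] -/
theorem tsum_deBruijnThetaMajorant_le {u : ℝ} (hu : 0 ≤ u) :
    ∑' n : ℕ, ((n : ℝ) + 1) ^ 4 * rexp (-(π * rexp (4 * u) * ((n : ℝ) + 1))) ≤
      deBruijnThetaS₄ * (rexp π * rexp (-(π * rexp (4 * u)))) := by
  rw [deBruijnThetaS₄, ← tsum_mul_right]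
  refine (summable_deBruijnThetaMajorant u).tsum_le_tsum (fun n ↦ ?_) (hasSum_deBruijnThetaS₄.summable.mul_right _)
  set m : ℝ := (n : ℝ) + 1 with hm
  have hm1 : 1 ≤ m := by simp [hm]
  have hx1 : 1 ≤ rexp (4 * u) := Real.one_le_exp (by linarith)
  rw [← Real.exp_add, mul_assoc (m ^ 4), ← Real.exp_add]
  gcongr
  have : 0 ≤ (rexp (4 * u) - 1) * (m - 1) := mul_nonneg (by linarith) (by linarith)
  nlinarith [Real.pi_pos]

/-- For `u ≥ 0` and `x = e^{4u}`: `e^{u} x² e^{π} e^{−π x} = e^{π} exp(9u − π e^{4u})` and lower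
powers of `x` are dominated (`1 ≤ x`). Master estimate: if `|f n| ≤ A e^{u} (n+1)⁴ e^{−π x (n+1)}`
termwise then `|∑ f n| ≤ A S₄ e^{π} e^{u} e^{−π x}`. [folklore] -/
theorem abs_tsum_le_of_deBruijnThetaMajorant {u A : ℝ} (hu : 0 ≤ u) (hA : 0 ≤ A) {f : ℕ → ℝ}
    (hf : ∀ n, |f n| ≤ A * rexp u *
      (((n : ℝ) + 1) ^ 4 * rexp (-(π * rexp (4 * u) * ((n : ℝ) + 1))))) :
    |∑' n, f n| ≤ A * deBruijnThetaS₄ * rexp π * (rexp u * rexp (-(π * rexp (4 * u)))) := by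
  have h1 : ‖∑' n, f n‖ ≤ A * rexp u *
      ∑' n : ℕ, ((n : ℝ) + 1) ^ 4 * rexp (-(π * rexp (4 * u) * ((n : ℝ) + 1))) :=
    tsum_of_norm_bounded ((summable_deBruijnThetaMajorant u).hasSum.mul_left _)
      fun n ↦ (Real.norm_eq_abs _).le.trans (hf n)
  rw [Real.norm_eq_abs] at h1
  refine h1.trans ?_
  have h2 := tsum_deBruijnThetaMajorant_le hu
  calc A * rexp u * ∑' n : ℕ, ((n : ℝ) + 1) ^ 4 * rexp (-(π * rexp (4 * u) * ((n : ℝ) + 1)))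
      ≤ A * rexp u * (deBruijnThetaS₄ * (rexp π * rexp (-(π * rexp (4 * u))))) := by gcongr
    _ = _ := by ring

/-- `|M(u)| ≤ 2 S₄ e^{π} exp(9u − π e^{4u})` for `u ≥ 0`. [folklore] -/
theorem abs_deBruijnThetaM_le {u : ℝ} (hu : 0 ≤ u) :
    |deBruijnThetaM u| ≤ 2 * deBruijnThetaS₄ * rexp π * rexp (9 * u - π * rexp (4 * u)) := by
  have hS : 0 ≤ deBruijnThetaS₄ := hasSum_deBruijnThetaS₄.nonneg fun n ↦ by positivity
  have h := abs_tsum_le_of_deBruijnThetaMajorant hu zero_le_two (f := fun n ↦ deBruijnThetaMTerm n u)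
    fun n ↦ abs_deBruijnThetaMTerm_le le_rfl le_rfl n
  refine h.trans ?_
  rw [← Real.exp_add, sub_eq_add_neg]
  gcongr
  linarith

/-- `|M'(u)| ≤ 2 (1 + 4π) S₄ e^{π} exp(9u − π e^{4u})` for `u ≥ 0`. [folklore] -/
theorem abs_deBruijnThetaM₁_le {u : ℝ} (hu : 0 ≤ u) :
    |deBruijnThetaM₁ u| ≤ 2 * (1 + 4 * π) * deBruijnThetaS₄ * rexp π * rexp (9 * u - π * rexp (4 * u)) := by
  have hx1 : 1 ≤ rexp (4 * u) := Real.one_le_exp (by linarith)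
  have hS : 0 ≤ deBruijnThetaS₄ := hasSum_deBruijnThetaS₄.nonneg fun n ↦ by positivity
  have h := abs_tsum_le_of_deBruijnThetaMajorant hu (A := 2 * (1 + 4 * π * rexp (4 * u))) (by positivity)
    (f := fun n ↦ deBruijnThetaMTerm₁ n u) fun n ↦ abs_deBruijnThetaMTerm₁_le le_rfl le_rfl n
  refine h.trans ?_
  have h5 : rexp (4 * u) * rexp u * rexp (-(π * rexp (4 * u))) ≤ rexp (9 * u - π * rexp (4 * u)) := by
    rw [← Real.exp_add, ← Real.exp_add, sub_eq_add_neg]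
    gcongr
    linarith
  have hlin : 1 + 4 * π * rexp (4 * u) ≤ (1 + 4 * π) * rexp (4 * u) := by nlinarith [Real.pi_pos]
  calc 2 * (1 + 4 * π * rexp (4 * u)) * deBruijnThetaS₄ * rexp π * (rexp u * rexp (-(π * rexp (4 * u))))
      ≤ 2 * ((1 + 4 * π) * rexp (4 * u)) * deBruijnThetaS₄ * rexp π *
          (rexp u * rexp (-(π * rexp (4 * u)))) := by gcongr
    _ = 2 * (1 + 4 * π) * deBruijnThetaS₄ * rexp π *
          (rexp (4 * u) * rexp u * rexp (-(π * rexp (4 * u)))) := by ring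
    _ ≤ _ := by gcongr

/-- `|M''(u)| ≤ 2 ((1 + 4π)² + 16π) S₄ e^{π} exp(9u − π e^{4u})` for `u ≥ 0`. [folklore] -/
theorem abs_deBruijnThetaM₂_le {u : ℝ} (hu : 0 ≤ u) :
    |deBruijnThetaM₂ u| ≤ 2 * ((1 + 4 * π) ^ 2 + 16 * π) * deBruijnThetaS₄ * rexp π *
      rexp (9 * u - π * rexp (4 * u)) := by
  have hx1 : 1 ≤ rexp (4 * u) := Real.one_le_exp (by linarith)
  have hS : 0 ≤ deBruijnThetaS₄ := hasSum_deBruijnThetaS₄.nonneg fun n ↦ by positivity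
  have h := abs_tsum_le_of_deBruijnThetaMajorant hu
    (A := 2 * ((1 + 4 * π * rexp (4 * u)) ^ 2 + 16 * π * rexp (4 * u))) (by positivity)
    (f := fun n ↦ deBruijnThetaMTerm₂ n u) fun n ↦ abs_deBruijnThetaMTerm₂_le le_rfl le_rfl n
  refine h.trans ?_
  have h9 : rexp (4 * u) ^ 2 * rexp u * rexp (-(π * rexp (4 * u))) =
      rexp (9 * u - π * rexp (4 * u)) := by
    rw [sq, ← Real.exp_add, ← Real.exp_add, ← Real.exp_add, sub_eq_add_neg]
    ring_nf
  have hquad : (1 + 4 * π * rexp (4 * u)) ^ 2 + 16 * π * rexp (4 * u) ≤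
      ((1 + 4 * π) ^ 2 + 16 * π) * rexp (4 * u) ^ 2 := by
    have : rexp (4 * u) ≤ rexp (4 * u) ^ 2 := by nlinarith
    nlinarith [Real.pi_pos, mul_le_mul_of_nonneg_left this Real.pi_pos.le]
  calc 2 * ((1 + 4 * π * rexp (4 * u)) ^ 2 + 16 * π * rexp (4 * u)) * deBruijnThetaS₄ * rexp π *
        (rexp u * rexp (-(π * rexp (4 * u))))
      ≤ 2 * (((1 + 4 * π) ^ 2 + 16 * π) * rexp (4 * u) ^ 2) * deBruijnThetaS₄ * rexp π *
        (rexp u * rexp (-(π * rexp (4 * u)))) := by gcongr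
    _ = 2 * ((1 + 4 * π) ^ 2 + 16 * π) * deBruijnThetaS₄ * rexp π *
        (rexp (4 * u) ^ 2 * rexp u * rexp (-(π * rexp (4 * u)))) := by ring
    _ = _ := by rw [h9]

/-- The common shape of the bounds: `∃ C, ∀ u ≥ 0, |M(u)|, |M'(u)|, |M''(u)| ≤ C exp(9u − π e^{4u})`.
[folklore] -/
theorem exists_deBruijnThetaM_bound : ∃ C : ℝ, ∀ u : ℝ, 0 ≤ u →
    |deBruijnThetaM u| ≤ C * rexp (9 * u - π * rexp (4 * u)) ∧
    |deBruijnThetaM₁ u| ≤ C * rexp (9 * u - π * rexp (4 * u)) ∧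
    |deBruijnThetaM₂ u| ≤ C * rexp (9 * u - π * rexp (4 * u)) := by
  have hS : 0 ≤ deBruijnThetaS₄ := hasSum_deBruijnThetaS₄.nonneg fun n ↦ by positivity
  have hSe : 0 ≤ deBruijnThetaS₄ * rexp π := mul_nonneg hS (Real.exp_pos π).le
  refine ⟨2 * ((1 + 4 * π) ^ 2 + 16 * π) * deBruijnThetaS₄ * rexp π, fun u hu ↦ ⟨?_, ?_, ?_⟩⟩
  · refine (abs_deBruijnThetaM_le hu).trans (mul_le_mul_of_nonneg_right ?_ (Real.exp_pos _).le)
    have hQ : (1 : ℝ) ≤ (1 + 4 * π) ^ 2 + 16 * π := by nlinarith [Real.pi_pos]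
    nlinarith [mul_le_mul_of_nonneg_left hQ hSe]
  · refine (abs_deBruijnThetaM₁_le hu).trans (mul_le_mul_of_nonneg_right ?_ (Real.exp_pos _).le)
    have hQ : (1 + 4 * π : ℝ) ≤ (1 + 4 * π) ^ 2 + 16 * π := by nlinarith [Real.pi_pos]
    nlinarith [mul_le_mul_of_nonneg_left hQ hSe]
  · exact abs_deBruijnThetaM₂_le hu

/-- The weight `exp(c u − π e^{4u})` is dominated by `e^{K} e^{−u}` on `u ≥ 0`
(`e^{4u} ≥ 1 + 4u + 8u²`). [folklore] -/
theorem exp_mul_sub_pi_exp_le (c : ℝ) : ∃ K : ℝ, ∀ u : ℝ, 0 ≤ u →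
    rexp (c * u - π * rexp (4 * u)) ≤ rexp K * rexp (-u) := by
  refine ⟨(c + 1) ^ 2 / (32 * π), fun u hu ↦ ?_⟩
  rw [← Real.exp_add]
  apply Real.exp_monotone
  have h4 : 1 + 4 * u + (4 * u) ^ 2 / 2 ≤ rexp (4 * u) := Real.quadratic_le_exp_of_nonneg (by linarith)
  have hπ : 0 < 32 * π := by positivity
  -- `(c+1) u − 8π u² ≤ (c+1)²/(32π)`
  have hsq : (c + 1) * u - 8 * π * u ^ 2 ≤ (c + 1) ^ 2 / (32 * π) := by
    rw [le_div_iff₀ hπ]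
    nlinarith [sq_nonneg (16 * π * u - (c + 1)), Real.pi_pos]
  nlinarith [Real.pi_pos]

/-- Integrability of `exp(c u − π e^{4u})` on `(0, ∞)`. [folklore] -/
theorem integrableOn_exp_mul_sub_pi_exp (c : ℝ) :
    MeasureTheory.IntegrableOn (fun u : ℝ ↦ rexp (c * u - π * rexp (4 * u))) (Ioi 0) := by
  obtain ⟨K, hK⟩ := exp_mul_sub_pi_exp_le c
  refine ((integrableOn_exp_neg_Ioi 0).const_mul (rexp K)).mono'
    (by fun_prop : Continuous fun u : ℝ ↦ rexp (c * u - π * rexp (4 * u))).aestronglyMeasurable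
    (MeasureTheory.ae_restrict_of_forall_mem measurableSet_Ioi fun u hu ↦ ?_)
  rw [Real.norm_eq_abs, abs_of_pos (Real.exp_pos _)]
  exact hK u (le_of_lt hu)

/-- `exp(c u − π e^{4u}) → 0` as `u → ∞`. [folklore] -/
theorem tendsto_exp_mul_sub_pi_exp (c : ℝ) :
    Tendsto (fun u : ℝ ↦ rexp (c * u - π * rexp (4 * u))) atTop (𝓝 0) := by
  obtain ⟨K, hK⟩ := exp_mul_sub_pi_exp_le c
  have hlim : Tendsto (fun u : ℝ ↦ rexp K * rexp (-u)) atTop (𝓝 0) := by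
    simpa using (Real.tendsto_exp_neg_atTop_nhds_zero).const_mul (rexp K)
  refine squeeze_zero' (Eventually.of_forall fun u ↦ (Real.exp_pos _).le) ?_ hlim
  filter_upwards [eventually_ge_atTop 0] with u hu using hK u hu

end Literature.NumberTheory.LFunctions

end
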